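import Literature.Analysis.FunctionSpaces.TorusSobolevL6
import HarnessLib

/-!
# The trilinear `H¹` estimate for the convective form on `T³`

Analysis/FunctionSpaces support file (everything proved; no definitions, no named facts).
On a three-dimensional flat torus `T^d` (`card d = 3`) the convective trilinear form
`b(z, a, u) = ∫ ⟪u, (z·∇)a⟫` is bounded on zero-mean smooth fields by the homogeneous `H¹`
(enstrophy) norms alone:

* `Torus.abs_integral_inner_convect_le_of_hasZeroMean` — there is `C ≥ 0` (depending only on the
  index type `d`) with `|∫ ⟪u, (z·∇)a⟫| ≤ C ‖∇u‖₂ ‖∇z‖₂ ‖∇a‖₂` for smooth `u z a : T^d → ℝ^d`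
  with `∫ u = ∫ z = 0`, `‖∇v‖₂ = √(Torus.gradNormSq v)`.  This is Temam's estimate
  `|b(u, v, w)| ≤ c ‖u‖ ‖v‖ ‖w‖` on `V` (Temam 1979, Ch. II §1, Lemma 1.1 with (1.13), `n = 3`)
  with the Dirichlet condition replaced by zero mean (which enters only through
  Poincaré–Wirtinger).  Proof: Hölder `L⁴ · L⁴ · L²`, the three-dimensional Ladyzhenskaya
  inequality `∫ ‖v‖⁴ ≤ K (∫‖v‖²)^{1/2} (∫‖Dv‖²)^{3/2}` (`Torus.integral_norm_pow_four_le_of_hasZeroMean`),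
  Poincaré–Wirtinger `‖v‖₂ ≤ d ‖Dv‖₂` (`Torus.eLpNorm_le_of_hasZeroMean`) and
  `∫ ‖Dv‖² ≤ d · gradNormSq v`.  The constant is `ν`-free and resolution-free, which is what the
  Galerkin/Newton–Kantorovich arguments for the steady Navier–Stokes equations need.
* the auxiliary real-integral forms `Torus.integral_norm_fderiv_sq_le_card_mul_gradNormSq`,
  `Torus.integral_norm_sq_le_of_hasZeroMean` / `Torus.integral_norm_sq_le_card_pow_mul_gradNormSq`
  (Poincaré–Wirtinger in `L²`, Bochner form), `Torus.sqrt_integral_norm_add_sq_le` (Minkowski in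
  `L²`, Bochner form) and `Torus.integral_norm_pow_four_le_gradNormSq_sq` (`∫ ‖v‖⁴ ≤ K ‖∇v‖₂⁴` for
  zero-mean `v` on `T³`) — the bookkeeping the energy/enstrophy margins of Galerkin–Newton
  arguments consume.

Constants are existential (they come from Mathlib's Gagliardo–Nirenberg–Sobolev constant).

## Mathlib / tree search

Tree: `TorusSobolevL6` (Ladyzhenskaya 3-D), `TorusPoincareMorrey` (`eLpNorm_le_of_hasZeroMean`),
`LadyzhenskayaTorus` (`norm_fderiv_sq_le_card_mul_sum`), `TorusEnstrophyTrilinear` (the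
`b(u,u,Δu)` estimate, different norms), `TorusAnisotropicLadyzhenskaya` (anisotropic variants);
no `H¹ × H¹ × H¹` bound of `∫ ⟪u, (z·∇)a⟫` (searched `inner_convect.*le`, `gradNormSq`).

## References

* R. Temam, *Navier–Stokes Equations. Theory and Numerical Analysis*, North-Holland (1979),
  Ch. II §1.1, Lemma 1.1 and (1.13). [Temam1979]
* C. Foias, O. Manley, R. Rosa, R. Temam, *Navier–Stokes Equations and Turbulence*, CUP (2001),
  Ch. II App. A, (A.26a), (A.27). [FoiasManleyRosaTemam2001]
-/

noncomputable section

open _root_.MeasureTheory Set Filter Function UnitAddTorus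
open scoped ENNReal NNReal InnerProductSpace Topology ContDiff

namespace Literature.Analysis.FunctionSpaces

namespace Torus

variable {d : Type*} [Fintype d] [DecidableEq d]

/-! ### Real-integral bookkeeping -/

omit [DecidableEq d] in
/-- Cauchy–Schwarz for nonnegative continuous functions on the torus, Bochner form:
`∫ f g ≤ √(∫ f²) √(∫ g²)`. [folklore] -/
theorem integral_mul_le_sqrt_mul_sqrt_of_continuous {f g : UnitAddTorus d → ℝ} (hf : Continuous f)
    (hg : Continuous g) (hf0 : ∀ x, 0 ≤ f x) (hg0 : ∀ x, 0 ≤ g x) :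
    ∫ x, f x * g x ≤ Real.sqrt (∫ x, f x ^ 2) * Real.sqrt (∫ x, g x ^ 2) := by
  have h2 : ENNReal.ofReal (2 : ℝ) = 2 := by simp
  have hfm : MemLp f 2 volume := hf.memLp_of_hasCompactSupport (HasCompactSupport.of_compactSpace f)
  have hgm : MemLp g 2 volume := hg.memLp_of_hasCompactSupport (HasCompactSupport.of_compactSpace g)
  have hH := integral_mul_le_Lp_mul_Lq_of_nonneg (μ := volume) Real.HolderConjugate.two_two
    (ae_of_all _ hf0) (ae_of_all _ hg0) (by rw [h2]; exact hfm) (by rw [h2]; exact hgm)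
  simp only [Real.rpow_two] at hH
  rwa [Real.sqrt_eq_rpow, Real.sqrt_eq_rpow]

omit [DecidableEq d] in
/-- The torus derivative of a smooth map is continuous (through the lift). [folklore] -/
theorem continuous_fderiv_of_isSmooth {F : Type*} [NormedAddCommGroup F] [NormedSpace ℝ F]
    {v : UnitAddTorus d → F} (hv : IsSmooth v) : Continuous (Torus.fderiv v) := by
  have e : lift (Torus.fderiv v) = _root_.fderiv ℝ (lift v) := funext fun y => (fderiv_lift v y).symm
  rw [← continuous_lift_iff, e]
  exact ContDiff.continuous_fderiv (hv.isContDiff (n := 1) (by simp)) one_ne_zero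

/-- `∫ ‖Dv‖² ≤ d · ‖∇v‖₂²` for smooth vector fields (`‖Dv(x)‖² ≤ d ∑ᵢ ‖∂ᵢv(x)‖²` pointwise,
`norm_fderiv_sq_le_card_mul_sum`). [folklore] -/
theorem integral_norm_fderiv_sq_le_card_mul_gradNormSq {v : UnitAddTorus d → EuclideanSpace ℝ d}
    (hv : IsSmooth v) :
    ∫ x, ‖Torus.fderiv v x‖ ^ 2 ≤ Fintype.card d * gradNormSq v := by
  have hc2 : Continuous fun x => ∑ i, ‖partialDeriv i v x‖ ^ 2 :=
    continuous_finsetSum _ fun i _ => (hv.partialDeriv i).continuous.norm.pow 2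
  calc ∫ x, ‖Torus.fderiv v x‖ ^ 2
      ≤ ∫ x, (Fintype.card d : ℝ) * ∑ i, ‖partialDeriv i v x‖ ^ 2 :=
        integral_mono ((continuous_fderiv_of_isSmooth hv).norm.pow 2).integrable_unitAddTorus
          (hc2.integrable_unitAddTorus.const_mul _)
          fun x => norm_fderiv_sq_le_card_mul_sum (hv.isContDiff (by simp)) x
    _ = Fintype.card d * gradNormSq v := by rw [integral_const_mul, gradNormSq]

omit [DecidableEq d] in
/-- **Poincaré–Wirtinger in `L²`, Bochner form**: `∫ ‖v‖² ≤ d² ∫ ‖Dv‖²` for smooth zero-mean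
maps on `T^d` (`Torus.eLpNorm_le_of_hasZeroMean` with `p = 2`, squared). [folklore] -/
theorem integral_norm_sq_le_of_hasZeroMean {F : Type*} [NormedAddCommGroup F] [NormedSpace ℝ F]
    [CompleteSpace F] {v : UnitAddTorus d → F} (hv : IsSmooth v) (h0 : HasZeroMean v) :
    ∫ x, ‖v x‖ ^ 2 ≤ (Fintype.card d : ℝ) ^ 2 * ∫ x, ‖Torus.fderiv v x‖ ^ 2 := by
  have hvc : Continuous v := hv.continuous
  have hDc : Continuous (Torus.fderiv v) := continuous_fderiv_of_isSmooth hv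
  -- the `L²` Poincaré inequality in `ℝ≥0∞`
  have hP : ∫⁻ x, ‖v x‖ₑ ^ 2 ≤ (Fintype.card d : ℝ≥0∞) ^ 2 * ∫⁻ x, ‖Torus.fderiv v x‖ₑ ^ 2 := by
    have h := eLpNorm_le_of_hasZeroMean (hv.isContDiff (by simp)) h0 (p := 2) (by norm_num)
      ENNReal.ofNat_ne_top
    have h2 := pow_le_pow_left' h 2
    rw [mul_pow, eLpNorm_two_pow_two_eq_lintegral, eLpNorm_two_pow_two_eq_lintegral] at h2
    simpa only [enorm_norm] using h2
  -- conversion to Bochner integrals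
  have conv : ∀ {g : UnitAddTorus d → ℝ} (_ : Continuous g) (_ : ∀ x, 0 ≤ g x),
      ∫⁻ x, (ENNReal.ofReal (g x)) ^ 2 = ENNReal.ofReal (∫ x, g x ^ 2) := by
    intro g hg hg0
    have hi : Integrable (fun x => g x ^ 2) volume := (hg.pow 2).integrable_unitAddTorus
    rw [ofReal_integral_eq_lintegral_ofReal hi (ae_of_all _ fun x => pow_nonneg (hg0 x) 2)]
    exact lintegral_congr fun x => (ENNReal.ofReal_pow (hg0 x) 2).symm
  have e2 : ∫⁻ x, ‖v x‖ₑ ^ 2 = ENNReal.ofReal (∫ x, ‖v x‖ ^ 2) := by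
    rw [← conv hvc.norm (fun x => norm_nonneg _)]
    exact lintegral_congr fun x => by rw [ofReal_norm]
  have eD : ∫⁻ x, ‖Torus.fderiv v x‖ₑ ^ 2 = ENNReal.ofReal (∫ x, ‖Torus.fderiv v x‖ ^ 2) := by
    rw [← conv hDc.norm (fun x => norm_nonneg _)]
    exact lintegral_congr fun x => by rw [ofReal_norm]
  have ecard : (Fintype.card d : ℝ≥0∞) ^ 2 = ENNReal.ofReal ((Fintype.card d : ℝ) ^ 2) := by
    rw [ENNReal.ofReal_pow (Nat.cast_nonneg _), ENNReal.ofReal_natCast]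
  have hB0 : 0 ≤ ∫ x, ‖Torus.fderiv v x‖ ^ 2 := integral_nonneg fun x => sq_nonneg _
  rw [e2, eD, ecard, ← ENNReal.ofReal_mul (sq_nonneg _)] at hP
  exact (ENNReal.ofReal_le_ofReal_iff (mul_nonneg (sq_nonneg _) hB0)).1 hP

/-- **Poincaré–Wirtinger by enstrophy**: `∫ ‖v‖² ≤ d³ · gradNormSq v` for smooth zero-mean vector
fields on `T^d` (`integral_norm_sq_le_of_hasZeroMean` and `∫ ‖Dv‖² ≤ d · gradNormSq v`; the sharp
spectral constant is `1/(4π²)`, not needed here). [folklore] -/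
theorem integral_norm_sq_le_card_pow_mul_gradNormSq {v : UnitAddTorus d → EuclideanSpace ℝ d}
    (hv : IsSmooth v) (h0 : HasZeroMean v) :
    ∫ x, ‖v x‖ ^ 2 ≤ (Fintype.card d : ℝ) ^ 3 * gradNormSq v := by
  calc ∫ x, ‖v x‖ ^ 2 ≤ (Fintype.card d : ℝ) ^ 2 * ∫ x, ‖Torus.fderiv v x‖ ^ 2 :=
        integral_norm_sq_le_of_hasZeroMean hv h0
    _ ≤ (Fintype.card d : ℝ) ^ 2 * (Fintype.card d * gradNormSq v) := by
        gcongr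
        exact integral_norm_fderiv_sq_le_card_mul_gradNormSq hv
    _ = (Fintype.card d : ℝ) ^ 3 * gradNormSq v := by ring

omit [DecidableEq d] in
/-- **Minkowski in `L²(T^d)` for continuous fields, Bochner form**:
`√(∫ ‖u + w‖²) ≤ √(∫ ‖u‖²) + √(∫ ‖w‖²)` (expand the square and use Cauchy–Schwarz). [folklore] -/
theorem sqrt_integral_norm_add_sq_le {F : Type*} [NormedAddCommGroup F] [InnerProductSpace ℝ F]
    {u w : UnitAddTorus d → F} (hu : Continuous u) (hw : Continuous w) :
    Real.sqrt (∫ x, ‖u x + w x‖ ^ 2) ≤ Real.sqrt (∫ x, ‖u x‖ ^ 2) + Real.sqrt (∫ x, ‖w x‖ ^ 2) := by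
  set A : ℝ := ∫ x, ‖u x‖ ^ 2 with hA
  set B : ℝ := ∫ x, ‖w x‖ ^ 2 with hB
  have hA0 : 0 ≤ A := integral_nonneg fun x => sq_nonneg _
  have hB0 : 0 ≤ B := integral_nonneg fun x => sq_nonneg _
  have iu : Integrable (fun x => ‖u x‖ ^ 2) volume := (hu.norm.pow 2).integrable_unitAddTorus
  have iw : Integrable (fun x => ‖w x‖ ^ 2) volume := (hw.norm.pow 2).integrable_unitAddTorus
  have iuw : Integrable (fun x => ‖u x‖ * ‖w x‖) volume := (hu.norm.mul hw.norm).integrable_unitAddTorus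
  -- `∫ ‖u + w‖² ≤ A + 2 √A √B + B = (√A + √B)²`
  have hCS : ∫ x, ‖u x‖ * ‖w x‖ ≤ Real.sqrt A * Real.sqrt B :=
    integral_mul_le_sqrt_mul_sqrt_of_continuous hu.norm hw.norm (fun x => norm_nonneg _)
      fun x => norm_nonneg _
  have hpt : ∀ x, ‖u x + w x‖ ^ 2 ≤ ‖u x‖ ^ 2 + 2 * (‖u x‖ * ‖w x‖) + ‖w x‖ ^ 2 := fun x => by
    nlinarith [norm_add_le (u x) (w x), norm_nonneg (u x + w x), norm_nonneg (u x), norm_nonneg (w x)]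
  have i1 : Integrable (fun x => 2 * (‖u x‖ * ‖w x‖)) volume := iuw.const_mul 2
  have i2 : Integrable (fun x => ‖u x‖ ^ 2 + 2 * (‖u x‖ * ‖w x‖)) volume := iu.add i1
  have i3 : Integrable (fun x => ‖u x‖ ^ 2 + 2 * (‖u x‖ * ‖w x‖) + ‖w x‖ ^ 2) volume := i2.add iw
  have hle : ∫ x, ‖u x + w x‖ ^ 2 ≤ (Real.sqrt A + Real.sqrt B) ^ 2 := by
    calc ∫ x, ‖u x + w x‖ ^ 2 ≤ ∫ x, (‖u x‖ ^ 2 + 2 * (‖u x‖ * ‖w x‖) + ‖w x‖ ^ 2) :=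
          integral_mono (((hu.add hw).norm.pow 2).integrable_unitAddTorus) i3 hpt
      _ = A + 2 * (∫ x, ‖u x‖ * ‖w x‖) + B := by
          rw [integral_add i2 iw, integral_add iu i1, integral_const_mul]
      _ ≤ A + 2 * (Real.sqrt A * Real.sqrt B) + B := by gcongr
      _ = (Real.sqrt A + Real.sqrt B) ^ 2 := by
          rw [add_sq, Real.sq_sqrt hA0, Real.sq_sqrt hB0]; ring
  calc Real.sqrt (∫ x, ‖u x + w x‖ ^ 2) ≤ Real.sqrt ((Real.sqrt A + Real.sqrt B) ^ 2) :=
        Real.sqrt_le_sqrt hle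
    _ = Real.sqrt A + Real.sqrt B := Real.sqrt_sq (by positivity)

/-- **Energy margin under an enstrophy-small zero-mean perturbation**: if `∫ ‖v‖² ≤ E` and the
smooth zero-mean correction `U − v` has `9 d³ · gradNormSq (U − v) ≤ E`, then `∫ ‖U‖² ≤ 2E`
(Poincaré–Wirtinger by enstrophy and Minkowski: `√∫‖U‖² ≤ √E + √E/3`). This is the energy
bookkeeping of Newton/Galerkin corrections measured in the enstrophy norm. [folklore] -/
theorem integral_norm_sq_le_two_mul_of_gradNormSq_sub_le {U v : UnitAddTorus d → EuclideanSpace ℝ d}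
    (hv : Continuous v) (hD : IsSmooth (U - v)) (h0 : HasZeroMean (U - v))
    {E : ℝ} (hE : ∫ x, ‖v x‖ ^ 2 ≤ E)
    (hsmall : 9 * (Fintype.card d : ℝ) ^ 3 * gradNormSq (U - v) ≤ E) :
    ∫ x, ‖U x‖ ^ 2 ≤ 2 * E := by
  have hE0 : 0 ≤ E := (integral_nonneg fun x => sq_nonneg _).trans hE
  set t : ℝ := Real.sqrt (∫ x, ‖(U - v) x‖ ^ 2) with ht
  have ht2 : t ^ 2 ≤ E / 9 := by
    rw [ht, Real.sq_sqrt (integral_nonneg fun x => sq_nonneg _)]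
    have h := integral_norm_sq_le_card_pow_mul_gradNormSq hD h0
    linarith
  have htE : t ≤ Real.sqrt E / 3 := by
    rw [le_div_iff₀ (by norm_num : (0 : ℝ) < 3)]
    refine le_of_pow_le_pow_left₀ two_ne_zero (Real.sqrt_nonneg E) ?_
    rw [Real.sq_sqrt hE0]
    calc (t * 3) ^ 2 = 9 * t ^ 2 := by ring
      _ ≤ 9 * (E / 9) := by gcongr
      _ = E := by ring
  have hMink : Real.sqrt (∫ x, ‖U x‖ ^ 2) ≤ Real.sqrt E + t := by
    have h := sqrt_integral_norm_add_sq_le (u := v) (w := U - v) hv hD.continuous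
    have e : (fun x => ‖v x + (U - v) x‖ ^ 2) = fun x => ‖U x‖ ^ 2 := by
      funext x; simp only [Pi.sub_apply, add_sub_cancel]
    rw [e] at h
    exact h.trans (add_le_add (Real.sqrt_le_sqrt hE) le_rfl)
  have hI0 : 0 ≤ ∫ x, ‖U x‖ ^ 2 := integral_nonneg fun x => sq_nonneg _
  calc ∫ x, ‖U x‖ ^ 2 = Real.sqrt (∫ x, ‖U x‖ ^ 2) ^ 2 := (Real.sq_sqrt hI0).symm
    _ ≤ (Real.sqrt E + t) ^ 2 := pow_le_pow_left₀ (Real.sqrt_nonneg _) hMink 2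
    _ ≤ (Real.sqrt E + Real.sqrt E / 3) ^ 2 := by gcongr
    _ = (16 / 9) * Real.sqrt E ^ 2 := by ring
    _ = (16 / 9) * E := by rw [Real.sq_sqrt hE0]
    _ ≤ 2 * E := by linarith

/-! ### `L⁴` by enstrophy on `T³` -/

/-- **`∫ ‖v‖⁴ ≤ K ‖∇v‖₂⁴` for zero-mean smooth fields on `T³`**: on `T^d` with `card d = 3`
there is `K ≥ 0` with `∫ ‖v‖⁴ ≤ K (gradNormSq v)²` for every smooth `v : T^d → ℝ^d` with
`∫ v = 0` — Ladyzhenskaya's inequality `∫ ‖v‖⁴ ≤ K' ‖v‖₂ ‖Dv‖₂³`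
(`Torus.integral_norm_pow_four_le_of_hasZeroMean`), Poincaré–Wirtinger `‖v‖₂ ≤ 3‖Dv‖₂` and
`‖Dv‖₂² ≤ 3 · gradNormSq v`. [cite: Temam1979, Ch. II §1.1 Lemma 1.1, (1.13)] -/
theorem integral_norm_pow_four_le_gradNormSq_sq (hd : Fintype.card d = 3) :
    ∃ K : ℝ, 0 ≤ K ∧ ∀ v : UnitAddTorus d → EuclideanSpace ℝ d, IsSmooth v → HasZeroMean v →
      ∫ x, ‖v x‖ ^ 4 ≤ K * gradNormSq v ^ 2 := by
  obtain ⟨K₄, hK₄⟩ := integral_norm_pow_four_le_of_hasZeroMean (F' := EuclideanSpace ℝ d) hd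
  have hK0 : (0 : ℝ) ≤ K₄ := NNReal.coe_nonneg K₄
  refine ⟨27 * K₄, by positivity, fun v hv h0 => ?_⟩
  set a : ℝ := ∫ x, ‖v x‖ ^ 2 with ha
  set b : ℝ := ∫ x, ‖Torus.fderiv v x‖ ^ 2 with hb
  set g : ℝ := gradNormSq v with hg
  have ha0 : 0 ≤ a := integral_nonneg fun x => sq_nonneg _
  have hb0 : 0 ≤ b := integral_nonneg fun x => sq_nonneg _
  have hg0 : 0 ≤ g := gradNormSq_nonneg v
  have hab : a ≤ 9 * b := by
    have h := integral_norm_sq_le_of_hasZeroMean hv h0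
    rw [hd] at h
    norm_num at h
    exact h
  have hbg : b ≤ 3 * g := by
    have h := integral_norm_fderiv_sq_le_card_mul_gradNormSq hv
    rw [hd] at h
    exact_mod_cast h
  have h := hK₄ v hv h0
  -- `a^{1/2} ≤ 3 b^{1/2}` and `b^{1/2} b^{3/2} = b²`
  have h1 : a ^ (1 / 2 : ℝ) ≤ 3 * b ^ (1 / 2 : ℝ) := by
    calc a ^ (1 / 2 : ℝ) ≤ (9 * b) ^ (1 / 2 : ℝ) := Real.rpow_le_rpow ha0 hab (by norm_num)
      _ = (9 : ℝ) ^ (1 / 2 : ℝ) * b ^ (1 / 2 : ℝ) := Real.mul_rpow (by norm_num) hb0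
      _ = 3 * b ^ (1 / 2 : ℝ) := by
          congr 1
          rw [show (9 : ℝ) = 3 ^ (2 : ℝ) by norm_num, ← Real.rpow_mul (by norm_num)]
          norm_num
  have h2 : b ^ (1 / 2 : ℝ) * b ^ (3 / 2 : ℝ) = b ^ 2 := by
    rw [← Real.rpow_add' hb0 (by norm_num), show (1 / 2 : ℝ) + 3 / 2 = 2 by norm_num,
      Real.rpow_two]
  have hb32 : 0 ≤ b ^ (3 / 2 : ℝ) := Real.rpow_nonneg hb0 _
  calc ∫ x, ‖v x‖ ^ 4 ≤ K₄ * a ^ (1 / 2 : ℝ) * b ^ (3 / 2 : ℝ) := h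
    _ ≤ K₄ * (3 * b ^ (1 / 2 : ℝ)) * b ^ (3 / 2 : ℝ) := by gcongr
    _ = 3 * K₄ * b ^ 2 := by rw [← h2]; ring
    _ ≤ 3 * K₄ * (3 * g) ^ 2 := by gcongr
    _ = 27 * K₄ * g ^ 2 := by ring

/-! ### The trilinear estimate -/

/-- **Temam's trilinear estimate on the homogeneous `H¹` scale, `n = 3`** (Temam 1979, Ch. II
§1.1, Lemma 1.1 with (1.13): "`|b(u, v, w)| ≤ c ‖u‖ ‖v‖ ‖w‖`", zero mean in place of the
Dirichlet condition): on `T^d` with `card d = 3` there is `C ≥ 0` such that for all smooth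
`u z a : T^d → ℝ^d` with `∫ u = ∫ z = 0`,
`|∫ ⟪u, (z·∇)a⟫| ≤ C √(gradNormSq u) √(gradNormSq z) √(gradNormSq a)`.
Proof: `|⟪u, Da[z]⟫| ≤ ‖u‖ ‖z‖ ‖Da‖` pointwise; Cauchy–Schwarz twice,
`∫ ‖u‖²‖z‖² ≤ √(∫‖u‖⁴) √(∫‖z‖⁴) ≤ K ‖∇u‖₂² ‖∇z‖₂²` (`integral_norm_pow_four_le_gradNormSq_sq`)
and `∫ ‖Da‖² ≤ 3 ‖∇a‖₂²`; `C = √(3K)`. [cite: Temam1979, Ch. II §1.1 Lemma 1.1, (1.13)] -/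
theorem abs_integral_inner_convect_le_of_hasZeroMean (hd : Fintype.card d = 3) :
    ∃ C : ℝ, 0 ≤ C ∧ ∀ u z a : UnitAddTorus d → EuclideanSpace ℝ d,
      IsSmooth u → IsSmooth z → IsSmooth a → HasZeroMean u → HasZeroMean z →
      |∫ x, ⟪u x, convect z a x⟫_ℝ| ≤
        C * Real.sqrt (gradNormSq u) * Real.sqrt (gradNormSq z) * Real.sqrt (gradNormSq a) := by
  obtain ⟨K, hK0, hK⟩ := integral_norm_pow_four_le_gradNormSq_sq (d := d) hd
  refine ⟨Real.sqrt (3 * K), Real.sqrt_nonneg _, fun u z a hu hz ha hu0 hz0 => ?_⟩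
  set gu : ℝ := gradNormSq u with hgu
  set gz : ℝ := gradNormSq z with hgz
  set ga : ℝ := gradNormSq a with hga
  have hgu0 : 0 ≤ gu := gradNormSq_nonneg u
  have hgz0 : 0 ≤ gz := gradNormSq_nonneg z
  have hga0 : 0 ≤ ga := gradNormSq_nonneg a
  set P : UnitAddTorus d → ℝ := fun x => ‖u x‖ * ‖z x‖ with hP
  set Q : UnitAddTorus d → ℝ := fun x => ‖Torus.fderiv a x‖ with hQ
  have hPc : Continuous P := hu.continuous.norm.mul hz.continuous.norm
  have hQc : Continuous Q := (continuous_fderiv_of_isSmooth ha).norm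
  have hP0 : ∀ x, 0 ≤ P x := fun x => mul_nonneg (norm_nonneg _) (norm_nonneg _)
  have hQ0 : ∀ x, 0 ≤ Q x := fun x => norm_nonneg _
  -- ### pointwise bound and the first Cauchy–Schwarz
  have hpt : ∀ x, ‖⟪u x, convect z a x⟫_ℝ‖ ≤ P x * Q x := fun x => by
    calc ‖⟪u x, convect z a x⟫_ℝ‖ ≤ ‖u x‖ * ‖convect z a x‖ := norm_inner_le_norm _ _
      _ ≤ ‖u x‖ * (‖Torus.fderiv a x‖ * ‖z x‖) :=
          mul_le_mul_of_nonneg_left (ContinuousLinearMap.le_opNorm _ _) (norm_nonneg _)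
      _ = P x * Q x := by simp only [hP, hQ]; ring
  have hI : |∫ x, ⟪u x, convect z a x⟫_ℝ| ≤ Real.sqrt (∫ x, P x ^ 2) * Real.sqrt (∫ x, Q x ^ 2) := by
    calc |∫ x, ⟪u x, convect z a x⟫_ℝ| = ‖∫ x, ⟪u x, convect z a x⟫_ℝ‖ := (Real.norm_eq_abs _).symm
      _ ≤ ∫ x, ‖⟪u x, convect z a x⟫_ℝ‖ := norm_integral_le_integral_norm _
      _ ≤ ∫ x, P x * Q x :=
          integral_mono_of_nonneg (ae_of_all _ fun x => norm_nonneg _)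
            (hPc.mul hQc).integrable_unitAddTorus (ae_of_all _ hpt)
      _ ≤ Real.sqrt (∫ x, P x ^ 2) * Real.sqrt (∫ x, Q x ^ 2) :=
          integral_mul_le_sqrt_mul_sqrt_of_continuous hPc hQc hP0 hQ0
  -- ### `∫ P² ≤ K gu gz` by the second Cauchy–Schwarz and the `L⁴` bound
  have hP2 : ∫ x, P x ^ 2 ≤ K * gu * gz := by
    have e4 : ∀ t : ℝ, (t ^ 2) ^ 2 = t ^ 4 := fun t => by ring
    have hcs : ∫ x, ‖u x‖ ^ 2 * ‖z x‖ ^ 2 ≤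
        Real.sqrt (∫ x, ‖u x‖ ^ 4) * Real.sqrt (∫ x, ‖z x‖ ^ 4) := by
      have h := integral_mul_le_sqrt_mul_sqrt_of_continuous (f := fun x => ‖u x‖ ^ 2)
        (g := fun x => ‖z x‖ ^ 2) (hu.continuous.norm.pow 2) (hz.continuous.norm.pow 2)
        (fun x => sq_nonneg _) (fun x => sq_nonneg _)
      simpa only [e4] using h
    have e1 : ∀ x, P x ^ 2 = ‖u x‖ ^ 2 * ‖z x‖ ^ 2 := fun x => by simp only [hP]; ring
    simp_rw [e1]
    refine hcs.trans ?_
    have h4u : Real.sqrt (∫ x, ‖u x‖ ^ 4) ≤ Real.sqrt K * gu := by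
      calc Real.sqrt (∫ x, ‖u x‖ ^ 4) ≤ Real.sqrt (K * gu ^ 2) := Real.sqrt_le_sqrt (hK u hu hu0)
        _ = Real.sqrt K * gu := by rw [Real.sqrt_mul hK0, Real.sqrt_sq hgu0]
    have h4z : Real.sqrt (∫ x, ‖z x‖ ^ 4) ≤ Real.sqrt K * gz := by
      calc Real.sqrt (∫ x, ‖z x‖ ^ 4) ≤ Real.sqrt (K * gz ^ 2) := Real.sqrt_le_sqrt (hK z hz hz0)
        _ = Real.sqrt K * gz := by rw [Real.sqrt_mul hK0, Real.sqrt_sq hgz0]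
    calc Real.sqrt (∫ x, ‖u x‖ ^ 4) * Real.sqrt (∫ x, ‖z x‖ ^ 4)
        ≤ (Real.sqrt K * gu) * (Real.sqrt K * gz) :=
          mul_le_mul h4u h4z (Real.sqrt_nonneg _) (by positivity)
      _ = K * gu * gz := by
          have : Real.sqrt K * Real.sqrt K = K := Real.mul_self_sqrt hK0
          linear_combination gu * gz * this
  -- ### `∫ Q² ≤ 3 ga`
  have hQ2 : ∫ x, Q x ^ 2 ≤ 3 * ga := by
    have h := integral_norm_fderiv_sq_le_card_mul_gradNormSq ha
    rw [hd] at h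
    exact_mod_cast h
  -- ### assembly
  calc |∫ x, ⟪u x, convect z a x⟫_ℝ| ≤ Real.sqrt (∫ x, P x ^ 2) * Real.sqrt (∫ x, Q x ^ 2) := hI
    _ ≤ Real.sqrt (K * gu * gz) * Real.sqrt (3 * ga) :=
        mul_le_mul (Real.sqrt_le_sqrt hP2) (Real.sqrt_le_sqrt hQ2) (Real.sqrt_nonneg _)
          (Real.sqrt_nonneg _)
    _ = Real.sqrt (3 * K) * Real.sqrt gu * Real.sqrt gz * Real.sqrt ga := by
        rw [Real.sqrt_mul (by positivity) gz, Real.sqrt_mul hK0 gu, Real.sqrt_mul (by norm_num) ga,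
          Real.sqrt_mul (by norm_num) K]
        ring

end Torus

end Literature.Analysis.FunctionSpaces

end
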